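import Literature.Probability.RandomPlanarGeometry.SLEHullBoundaryArea
import HarnessLib

/-!
# The boundary of the SLE_κ hull is Lebesgue-null for every `κ ≥ 8` (Rohde–Schramm, Cor. 5.3), from Cor. 3.5

Trunk T-STOCH. `SLEHullBoundaryArea.lean` proves Rohde–Schramm's Corollary 5.3 (*Basic
properties of SLE*, Ann. of Math. 161 (2005), §5: for every `t`, a.s. `area ∂Kₜ = 0`) at
`κ = 8` from the derivative estimate Cor. 3.5 (`RohdeSchramm2005_cor35`). The same argument runs
for **every `κ ≥ 8`** with the admissible exponent `b = 7/(2κ)` in Cor. 3.5 (then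
`λ = 7/4 + 7/(4κ)`, `a - λ = -7/(8κ) < 0`) and the Hölder exponent `h = 1/40`: the bad events
`|f̂ₜ'(z_{j,n})| ≥ (2ⁿ)^{39/40}`, `|j| ≤ R 2ⁿ`, have total probability
`≤ K_R (2ⁿ)^{1 + e(κ)}`, `e(κ) = 7/κ - (39/40) λ`, and `1 + e(κ) ≤ -57/1280 < 0` for
`κ ≥ 8`. This file records that generalisation:

* `RohdeSchramm2005_cor35.measure_grid_plane_le_of_le`, `RohdeSchramm2005_cor35.ae_exists_grid_plane_of_le`
  — (5.4) on the planar dyadic grid, `κ ≥ 8`, almost surely (Borel–Cantelli);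
* `Loewner.IsGeneratedByCurve.norm_fHat_sub_bdryInv_le_of_grid` — the vertical Hölder approach
  for a general grid exponent (Koebe distortion, `norm_deriv_le_rpow_of_grid`,
  `norm_sub_le_rpow_of_deriv`);
* `ae_volume_frontier_hull_eq_zero_of_cor35_of_le` (general Brownian motion, `t ≤ 1`) and
  `ae_volume_frontier_sleHull_eq_zero_of_cor35` (canonical space, `HasSLETrace κ`, every `t`) —
  **Cor. 5.3 for `κ ≥ 8` from Cor. 3.5** (porosity/density lemma
  `Literature.Analysis.Complex.volume_eq_zero_of_norm_sub_le_rpow` in place of Jones–Makarov);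
* `tendsto_norm_sleTrace_atTop_of_cor35_of_simpleStep_four_of_eight` — **Rohde–Schramm's
  Thm. 7.1 with the Update (`tendsto_norm_sleTrace_atTop`, all `κ > 0`) from Cor. 3.5, the
  simple-path step of p. 911 at `κ = 4`, and [LSW] Thm. 4.7 (`hasSLETrace_eight`) only**: the
  `κ ≥ 8` inputs of `tendsto_norm_sleTrace_atTop_of_cor35_of_smallbd` (`SLETransienceKappaEight`)
  are now theorems.

## References

* S. Rohde, O. Schramm, *Basic properties of SLE*, Ann. of Math. 161 (2005): Cor. 3.5, Thm. 5.2
  (proof, eq. (5.4)), Cor. 5.3, Lemma 7.3, Thm. 7.1 and Update (p. 911).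
* G. F. Lawler, O. Schramm, W. Werner, *Conformal invariance of planar loop-erased random walks
  and uniform spanning trees*, Ann. Probab. 32 (2004), Thm. 4.7.
-/

noncomputable section

open Set Filter Topology Metric Complex MeasureTheory ProbabilityTheory
open UpperHalfPlane (upperHalfPlaneSet isOpen_upperHalfPlaneSet)
open scoped NNReal ENNReal Pointwise

namespace Literature.Probability.RandomPlanarGeometry

open Literature.Analysis.Complex Literature.Analysis.Complex.AreaThm

/-! ### Exponent bookkeeping for `b = 7/(2κ)` -/

/-- `λ(κ, 7/(2κ)) = 7/4 + 7/(4κ)`. [cite: RohdeSchramm2005, eq. (3.6)] -/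
theorem expLam_seven_div (κ : ℝ) (hκ : κ ≠ 0) :
    RohdeSchramm.expLam κ (7 / (2 * κ)) = 7 / 4 + 7 / (4 * κ) := by
  rw [RohdeSchramm.expLam]
  field_simp
  ring

/-- `a(κ, 7/(2κ)) - λ(κ, 7/(2κ)) = -7/(8κ) < 0`. [cite: RohdeSchramm2005, eq. (3.6)] -/
theorem expA_sub_expLam_seven_div_neg {κ : ℝ} (hκ : 0 < κ) :
    RohdeSchramm.expA κ (7 / (2 * κ)) - RohdeSchramm.expLam κ (7 / (2 * κ)) < 0 := by
  have h : RohdeSchramm.expA κ (7 / (2 * κ)) - RohdeSchramm.expLam κ (7 / (2 * κ)) =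
      -(7 / (8 * κ)) := by
    rw [RohdeSchramm.expA, RohdeSchramm.expLam]
    field_simp
    ring
  rw [h, neg_lt_zero]
  positivity

/-- The exponent `e(κ) = 7/κ - (39/40)(7/4 + 7/(4κ))` of `2ⁿ` in the one-point bound on the
planar grid (`b = 7/(2κ)`, `h = 1/40`) satisfies `1 + e(κ) ≤ -57/1280 < 0` for `κ ≥ 8`.
[folklore] -/
theorem one_add_gridExp_lt {κ : ℝ} (hκ : 8 ≤ κ) :
    1 + (7 / (κ : ℝ) - 39 / 40 * (7 / 4 + 7 / (4 * (κ : ℝ)))) < 0 := by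
  have hκ0 : 0 < κ := lt_of_lt_of_le (by norm_num) hκ
  have h1 : 1 + (7 / (κ : ℝ) - 39 / 40 * (7 / 4 + 7 / (4 * (κ : ℝ)))) =
      -(113 / 160) + 847 / 160 / κ := by
    field_simp
    ring
  have h2 : 847 / 160 / κ ≤ 847 / 160 / 8 := div_le_div_of_nonneg_left (by norm_num) (by norm_num) hκ
  rw [h1]
  linarith

/-- `2ⁿ · (2ⁿ)ᵉ = (2^{1+e})ⁿ`. [folklore] -/
theorem two_pow_mul_rpow (e : ℝ) (n : ℕ) :
    (2 : ℝ) ^ n * ((2 : ℝ) ^ n) ^ e = ((2 : ℝ) ^ (1 + e)) ^ n := by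
  have h0 : (0 : ℝ) < (2 : ℝ) ^ n := by positivity
  rw [Real.rpow_pow_comm zero_le_two,
    show (2 : ℝ) ^ n * ((2 : ℝ) ^ n) ^ e = ((2 : ℝ) ^ n) ^ (1 : ℝ) * ((2 : ℝ) ^ n) ^ e by
      rw [Real.rpow_one],
    ← Real.rpow_add h0]

/-! ### (5.4) on the planar dyadic grid, `κ ≥ 8` -/

section Grid

variable {Ω : Type*} [MeasurableSpace Ω] {P : Measure Ω}

/-- **The one-point bound on the planar grid, `κ ≥ 8`** (Cor. 3.5 with `b = 7/(2κ)` at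
`z_{j,n} = (j + i)/N`, `N = 2ⁿ`, `δ = N^{-1/40}`): for `t ≤ 1` and `|j| ≤ R N`,
`P[|f̂ₜ'(z_{j,n})| ≥ N^{39/40}] ≤ C (1 + R²)^{7/(2κ)} N^{e(κ)}`.
[cite: RohdeSchramm2005, Thm 5.2 (proof, (5.4))] -/
theorem RohdeSchramm2005_cor35.measure_grid_plane_le_of_le {κ : ℝ≥0} (hκ : 8 ≤ κ) {C : ℝ}
    (hC : ∀ (B : ℝ≥0 → Ω → ℝ), IsBrownianReal B P → (∀ ω, Continuous (B · ω)) →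
      ∀ (t : ℝ≥0), t ≤ 1 → ∀ (x y δ : ℝ), 0 < y → y ≤ 1 → 0 < δ → δ ≤ 1 →
        P {ω | δ / y ≤ ‖deriv (Loewner.fHat (fun s ↦ Real.sqrt κ * B s ω) t) (x + I * y)‖} ≤
          ENNReal.ofReal (C * (1 + x ^ 2 / y ^ 2) ^ (7 / (2 * (κ : ℝ))) *
            (y / δ) ^ RohdeSchramm.expLam κ (7 / (2 * (κ : ℝ))) *
            RohdeSchramm.theta δ (RohdeSchramm.expA κ (7 / (2 * (κ : ℝ))) -
              RohdeSchramm.expLam κ (7 / (2 * (κ : ℝ))))))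
    {B : ℝ≥0 → Ω → ℝ} (hB : IsBrownianReal B P) (hBc : ∀ ω, Continuous (B · ω))
    {t : ℝ≥0} (ht : t ≤ 1) (R n : ℕ) {j : ℤ} (hj : |(j : ℝ)| ≤ R * 2 ^ n) :
    P {ω | ((2 : ℝ) ^ n) ^ (39 / 40 : ℝ) ≤
        ‖deriv (Loewner.fHat (fun s ↦ Real.sqrt κ * B s ω) t)
          (↑((j : ℝ) * ((2 : ℝ) ^ n)⁻¹) + I * ↑(((2 : ℝ) ^ n)⁻¹))‖} ≤
      ENNReal.ofReal (max C 0 * (1 + (R : ℝ) ^ 2) ^ (7 / (2 * (κ : ℝ))) *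
        ((2 : ℝ) ^ n) ^ (7 / (κ : ℝ) - 39 / 40 * (7 / 4 + 7 / (4 * (κ : ℝ))))) := by
  have hκ0 : (0 : ℝ) < κ := lt_of_lt_of_le (by norm_num) (show (8 : ℝ) ≤ κ by exact_mod_cast hκ)
  have hb0 : (0 : ℝ) ≤ 7 / (2 * (κ : ℝ)) := by positivity
  set N : ℝ := (2 : ℝ) ^ n with hN_def
  have hN0 : 0 < N := by positivity
  have hN1 : 1 ≤ N := one_le_pow₀ one_le_two
  set δ : ℝ := N ^ (-(1 / 40) : ℝ) with hδ_def
  have hδ0 : 0 < δ := Real.rpow_pos_of_pos hN0 _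
  have hδ1 : δ ≤ 1 := Real.rpow_le_one_of_one_le_of_nonpos hN1 (by norm_num)
  have hy0 : 0 < N⁻¹ := inv_pos.2 hN0
  have hy1 : N⁻¹ ≤ 1 := inv_le_one_of_one_le₀ hN1
  have hthr : δ / N⁻¹ = N ^ (39 / 40 : ℝ) := by
    rw [hδ_def, div_inv_eq_mul, ← Real.rpow_add_one hN0.ne']
    norm_num
  have h := hC B hB hBc t ht ((j : ℝ) * N⁻¹) N⁻¹ δ hy0 hy1 hδ0 hδ1
  rw [hthr] at h
  refine h.trans (ENNReal.ofReal_le_ofReal ?_)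
  rw [RohdeSchramm.theta_of_neg _ (expA_sub_expLam_seven_div_neg hκ0), mul_one,
    expLam_seven_div _ hκ0.ne']
  have hx : 1 + ((j : ℝ) * N⁻¹) ^ 2 / N⁻¹ ^ 2 = 1 + (j : ℝ) ^ 2 := by
    field_simp
  have hratio : N⁻¹ / δ = N ^ (-(39 / 40) : ℝ) := by
    rw [hδ_def, ← Real.rpow_neg_one, ← Real.rpow_sub hN0]
    norm_num
  have hpow1 : (N ^ (-(39 / 40) : ℝ)) ^ (7 / 4 + 7 / (4 * (κ : ℝ))) =
      N ^ (-(39 / 40) * (7 / 4 + 7 / (4 * (κ : ℝ)))) := by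
    rw [← Real.rpow_mul hN0.le]
  rw [hx, hratio, hpow1]
  -- `(1 + j²)^b ≤ (1 + R²)^b N^{2b}`, `2b = 7/κ`
  have hj2 : (j : ℝ) ^ 2 ≤ (R : ℝ) ^ 2 * N ^ 2 := by
    rw [← sq_abs (j : ℝ)]
    have h0 : 0 ≤ |(j : ℝ)| := abs_nonneg _
    calc |(j : ℝ)| ^ 2 ≤ ((R : ℝ) * N) ^ 2 := by gcongr
      _ = (R : ℝ) ^ 2 * N ^ 2 := by ring
  have hbase : 1 + (j : ℝ) ^ 2 ≤ (1 + (R : ℝ) ^ 2) * N ^ 2 := by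
    have : (1 : ℝ) ≤ N ^ 2 := one_le_pow₀ hN1
    nlinarith
  have h2b : ((2 : ℕ) : ℝ) * (7 / (2 * (κ : ℝ))) = 7 / (κ : ℝ) := by
    push_cast
    field_simp
  have hb : (1 + (j : ℝ) ^ 2) ^ (7 / (2 * (κ : ℝ))) ≤
      (1 + (R : ℝ) ^ 2) ^ (7 / (2 * (κ : ℝ))) * N ^ (7 / (κ : ℝ)) := by
    calc (1 + (j : ℝ) ^ 2) ^ (7 / (2 * (κ : ℝ)))
        ≤ ((1 + (R : ℝ) ^ 2) * N ^ 2) ^ (7 / (2 * (κ : ℝ))) :=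
          Real.rpow_le_rpow (by positivity) hbase hb0
      _ = (1 + (R : ℝ) ^ 2) ^ (7 / (2 * (κ : ℝ))) * (N ^ 2) ^ (7 / (2 * (κ : ℝ))) :=
          Real.mul_rpow (by positivity) (by positivity)
      _ = (1 + (R : ℝ) ^ 2) ^ (7 / (2 * (κ : ℝ))) * N ^ (7 / (κ : ℝ)) := by
          rw [← Real.rpow_natCast_mul hN0.le, h2b]
  have hprod : N ^ (7 / (κ : ℝ)) * N ^ (-(39 / 40) * (7 / 4 + 7 / (4 * (κ : ℝ)))) =
      N ^ (7 / (κ : ℝ) - 39 / 40 * (7 / 4 + 7 / (4 * (κ : ℝ)))) := by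
    rw [← Real.rpow_add hN0]
    congr 1
    ring
  calc C * (1 + (j : ℝ) ^ 2) ^ (7 / (2 * (κ : ℝ))) * N ^ (-(39 / 40) * (7 / 4 + 7 / (4 * (κ : ℝ))))
      ≤ max C 0 * (1 + (j : ℝ) ^ 2) ^ (7 / (2 * (κ : ℝ))) *
          N ^ (-(39 / 40) * (7 / 4 + 7 / (4 * (κ : ℝ)))) := by
        gcongr
        exact le_max_left _ _
    _ ≤ max C 0 * ((1 + (R : ℝ) ^ 2) ^ (7 / (2 * (κ : ℝ))) * N ^ (7 / (κ : ℝ))) *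
          N ^ (-(39 / 40) * (7 / 4 + 7 / (4 * (κ : ℝ)))) := by
        gcongr
    _ = max C 0 * (1 + (R : ℝ) ^ 2) ^ (7 / (2 * (κ : ℝ))) *
          (N ^ (7 / (κ : ℝ)) * N ^ (-(39 / 40) * (7 / 4 + 7 / (4 * (κ : ℝ))))) := by ring
    _ = max C 0 * (1 + (R : ℝ) ^ 2) ^ (7 / (2 * (κ : ℝ))) * N ^ (7 / (κ : ℝ) - 39 / 40 * (7 / 4 + 7 / (4 * (κ : ℝ)))) := by rw [hprod]

/-- **(5.4) on the planar dyadic grid, `κ ≥ 8`, almost surely** (Borel–Cantelli on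
`RohdeSchramm2005_cor35.measure_grid_plane_le_of_le`): for a Brownian motion `B` with continuous paths,
`t ≤ 1` and `R ∈ ℕ`, almost surely there is `c` with `|f̂ₜ'((j + i) 2⁻ⁿ)| ≤ c (2ⁿ)^{39/40}` for all
`n ∈ ℕ` and all integers `|j| ≤ R 2ⁿ` (the `3R2ⁿ` bad events at level `n` have total probability
`≤ K_R (2ⁿ)^{1 + e(κ)}`, `1 + e(κ) < 0`, a summable series; finitely many exceptional levels are absorbed into `c`).
Rohde–Schramm (2005), proof of Thm. 5.2, eq. (5.4) with `b = 7/(2κ)`, `h = 1/40`.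
[cite: RohdeSchramm2005, Thm 5.2 (proof, (5.4))] -/
theorem RohdeSchramm2005_cor35.ae_exists_grid_plane_of_le (h : RohdeSchramm2005_cor35 P) {κ : ℝ≥0}
    (hκ : 8 ≤ κ)
    {B : ℝ≥0 → Ω → ℝ} (hB : IsBrownianReal B P) (hBc : ∀ ω, Continuous (B · ω))
    {t : ℝ≥0} (ht : t ≤ 1) (R : ℕ) :
    ∀ᵐ ω ∂P, ∃ c : ℝ, ∀ (n : ℕ) (j : ℤ), |(j : ℝ)| ≤ R * 2 ^ n →
      ‖deriv (Loewner.fHat (fun s ↦ Real.sqrt κ * B s ω) t)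
        (↑((j : ℝ) * ((2 : ℝ) ^ n)⁻¹) + I * ↑(((2 : ℝ) ^ n)⁻¹))‖ ≤
        c * ((2 : ℝ) ^ n) ^ (39 / 40 : ℝ) := by
  have hκ0 : κ ≠ 0 := (lt_of_lt_of_le (by norm_num) hκ).ne'
  have hκR : (0 : ℝ) < κ := by exact_mod_cast pos_iff_ne_zero.2 hκ0
  have hκ8 : (8 : ℝ) ≤ κ := by exact_mod_cast hκ
  obtain ⟨C, hC⟩ := h κ hκ0 (7 / (2 * (κ : ℝ))) (by positivity) (by
    rw [div_le_iff₀ (by positivity)]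
    have : (0 : ℝ) ≤ 4 / (κ : ℝ) := by positivity
    nlinarith)
  -- the grid values and the bad events
  set D : Ω → ℕ → ℤ → ℝ := fun ω n j ↦
    ‖deriv (Loewner.fHat (fun s ↦ Real.sqrt κ * B s ω) t)
      (↑((j : ℝ) * ((2 : ℝ) ^ n)⁻¹) + I * ↑(((2 : ℝ) ^ n)⁻¹))‖ with hD
  set J : ℕ → Finset ℤ := fun n ↦ Finset.Icc (-((R * 2 ^ n : ℕ) : ℤ)) ((R * 2 ^ n : ℕ) : ℤ) with hJ
  have hJmem : ∀ (n : ℕ) (j : ℤ), j ∈ J n ↔ |(j : ℝ)| ≤ R * 2 ^ n := by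
    intro n j
    rw [hJ, Finset.mem_Icc, ← Int.cast_abs, show (R : ℝ) * 2 ^ n = ((R * 2 ^ n : ℕ) : ℤ) by
      push_cast; ring, Int.cast_le, abs_le]
  have hJcard : ∀ n : ℕ, ((J n).card : ℝ) ≤ (2 * R + 1) * 2 ^ n := by
    intro n
    rw [hJ, Int.card_Icc, show ((R * 2 ^ n : ℕ) : ℤ) + 1 - -((R * 2 ^ n : ℕ) : ℤ) =
      ((2 * (R * 2 ^ n) + 1 : ℕ) : ℤ) by push_cast; ring, Int.toNat_natCast]
    have : (1 : ℝ) ≤ 2 ^ n := one_le_pow₀ one_le_two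
    push_cast
    nlinarith
  set A : ℕ → Set Ω := fun n ↦ ⋃ j ∈ J n, {ω | ((2 : ℝ) ^ n) ^ (39 / 40 : ℝ) ≤ D ω n j} with hA
  set K : ℝ := max C 0 * (1 + (R : ℝ) ^ 2) ^ (7 / (2 * (κ : ℝ))) with hK
  have hK0 : 0 ≤ K := mul_nonneg (le_max_right _ _) (Real.rpow_nonneg (by positivity) _)
  set r : ℝ := (2 : ℝ) ^ (1 + (7 / (κ : ℝ) - 39 / 40 * (7 / 4 + 7 / (4 * (κ : ℝ))))) with hr
  have hr0 : 0 ≤ r := Real.rpow_nonneg zero_le_two _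
  have hr1 : r < 1 := Real.rpow_lt_one_of_one_lt_of_neg one_lt_two (one_add_gridExp_lt hκ8)
  have hbound : ∀ n, P (A n) ≤ ENNReal.ofReal ((2 * R + 1) * K * r ^ n) := by
    intro n
    have hN0 : (0 : ℝ) < 2 ^ n := by positivity
    calc P (A n) ≤ ∑ j ∈ J n, P {ω | ((2 : ℝ) ^ n) ^ (39 / 40 : ℝ) ≤ D ω n j} :=
          measure_biUnion_finset_le _ _
      _ ≤ ∑ _j ∈ J n, ENNReal.ofReal (K * ((2 : ℝ) ^ n) ^ (7 / (κ : ℝ) - 39 / 40 * (7 / 4 + 7 / (4 * (κ : ℝ))))) :=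
          Finset.sum_le_sum fun j hj ↦
            RohdeSchramm2005_cor35.measure_grid_plane_le_of_le hκ hC hB hBc ht R n ((hJmem n j).1 hj)
      _ = ENNReal.ofReal ((J n).card * (K * ((2 : ℝ) ^ n) ^ (7 / (κ : ℝ) - 39 / 40 * (7 / 4 + 7 / (4 * (κ : ℝ)))))) := by
          rw [Finset.sum_const, nsmul_eq_mul, ENNReal.ofReal_mul (Nat.cast_nonneg _),
            ENNReal.ofReal_natCast]
      _ ≤ ENNReal.ofReal ((2 * R + 1) * 2 ^ n * (K * ((2 : ℝ) ^ n) ^ (7 / (κ : ℝ) - 39 / 40 * (7 / 4 + 7 / (4 * (κ : ℝ)))))) := by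
          apply ENNReal.ofReal_le_ofReal
          have : 0 ≤ K * ((2 : ℝ) ^ n) ^ (7 / (κ : ℝ) - 39 / 40 * (7 / 4 + 7 / (4 * (κ : ℝ)))) := mul_nonneg hK0 (Real.rpow_nonneg hN0.le _)
          exact mul_le_mul_of_nonneg_right (hJcard n) this
      _ = ENNReal.ofReal ((2 * R + 1) * K * r ^ n) := by
          rw [hr, ← two_pow_mul_rpow ((7 / (κ : ℝ) - 39 / 40 * (7 / 4 + 7 / (4 * (κ : ℝ))))) n]; ring_nf
  have hsum : ∑' n, P (A n) ≠ ∞ := by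
    refine ne_top_of_le_ne_top ?_ (ENNReal.tsum_le_tsum hbound)
    have hnn : ∀ n : ℕ, 0 ≤ (2 * R + 1) * K * r ^ n := fun n ↦ by positivity
    rw [← ENNReal.ofReal_tsum_of_nonneg hnn
      (((summable_geometric_of_lt_one hr0 hr1).mul_left ((2 * R + 1) * K)))]
    exact ENNReal.ofReal_ne_top
  filter_upwards [ae_eventually_notMem hsum] with ω hω
  obtain ⟨n₀, hn₀⟩ := eventually_atTop.1 hω
  have hgood : ∀ n, n₀ ≤ n → ∀ j ∈ J n, D ω n j < ((2 : ℝ) ^ n) ^ (39 / 40 : ℝ) := by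
    intro n hn j hj
    have := hn₀ n hn
    simp only [hA, mem_iUnion, mem_setOf_eq, not_exists, not_le, exists_prop, not_and] at this
    exact this j hj
  -- absorb the finitely many levels `n < n₀`
  have hD0 : ∀ n j, 0 ≤ D ω n j := fun n j ↦ norm_nonneg _
  obtain ⟨M, hM0, hMle⟩ : ∃ M : ℝ, 0 ≤ M ∧ ∀ n j, n < n₀ → j ∈ J n → D ω n j ≤ M := by
    refine ⟨∑ n ∈ Finset.range n₀, ∑ j ∈ J n, D ω n j,
      Finset.sum_nonneg fun n _ ↦ Finset.sum_nonneg fun j _ ↦ hD0 n j, fun n j hn hj ↦ ?_⟩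
    calc D ω n j ≤ ∑ j' ∈ J n, D ω n j' :=
          Finset.single_le_sum (f := fun j' ↦ D ω n j') (fun j' _ ↦ hD0 n j') hj
      _ ≤ ∑ n' ∈ Finset.range n₀, ∑ j' ∈ J n', D ω n' j' :=
          Finset.single_le_sum (f := fun n' ↦ ∑ j' ∈ J n', D ω n' j')
            (fun n' _ ↦ Finset.sum_nonneg fun j' _ ↦ hD0 n' j') (Finset.mem_range.2 hn)
  have hpow : ∀ n : ℕ, 1 ≤ ((2 : ℝ) ^ n) ^ (39 / 40 : ℝ) := fun n ↦
    Real.one_le_rpow (one_le_pow₀ one_le_two) (by norm_num)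
  refine ⟨max 1 M, fun n j hj ↦ ?_⟩
  have hjJ : j ∈ J n := (hJmem n j).2 hj
  show D ω n j ≤ max 1 M * ((2 : ℝ) ^ n) ^ (39 / 40 : ℝ)
  rcases lt_or_ge n n₀ with hn | hn
  · calc D ω n j ≤ M := hMle n j hn hjJ
      _ ≤ max 1 M * 1 := by rw [mul_one]; exact le_max_right _ _
      _ ≤ max 1 M * ((2 : ℝ) ^ n) ^ (39 / 40 : ℝ) :=
          mul_le_mul_of_nonneg_left (hpow n) (le_trans zero_le_one (le_max_left _ _))
  · calc D ω n j ≤ ((2 : ℝ) ^ n) ^ (39 / 40 : ℝ) := (hgood n hn j hjJ).le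
      _ = 1 * ((2 : ℝ) ^ n) ^ (39 / 40 : ℝ) := (one_mul _).symm
      _ ≤ max 1 M * ((2 : ℝ) ^ n) ^ (39 / 40 : ℝ) :=
          mul_le_mul_of_nonneg_right (le_max_left _ _) (Real.rpow_nonneg (by positivity) _)

end Grid

/-! ### Cor. 5.3 for `κ ≥ 8` -/

namespace Loewner

variable {W : ℝ≥0 → ℝ} {γ : ℝ≥0 → ℂ}

/-- **The vertical Hölder approach of `f̂ₜ` to its boundary values, from a grid bound** (chain
generated by a curve): if `|f̂ₜ'((j + i)2⁻ⁿ)| ≤ c (2ⁿ)ᵉ` (`0 < e < 1`) for `|j| ≤ R 2ⁿ`, then for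
`|x| + 1 ≤ R` and `0 < σ ≤ 1`, `|f̂ₜ(x + iσ) - f̄ₜ(W_t + x)| ≤ K σ^{1-e}` with
`K = 2 · 12⁴ c/(1 - 2^{e-1})` (`norm_deriv_le_rpow_of_grid`, `norm_sub_le_rpow_of_deriv`, and
`f̂ₜ(x + iσ2⁻ᴺ) → f̄ₜ(W_t + x)`, `IsGeneratedByCurve.tendsto_bdryInv`). Rohde–Schramm (2005),
proof of Thm. 5.2 (p. 901). [cite: RohdeSchramm2005, Thm 5.2 (proof)] -/
theorem IsGeneratedByCurve.norm_fHat_sub_bdryInv_le_of_grid (hγ : IsGeneratedByCurve W γ)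
    (hW : Continuous W) (t : ℝ≥0) {c e : ℝ} (he0 : 0 < e) (he1 : e < 1) {R : ℕ}
    (hgrid : ∀ (n : ℕ) (j : ℤ), |(j : ℝ)| ≤ R * 2 ^ n →
      ‖deriv (fHat W t) (↑((j : ℝ) * ((2 : ℝ) ^ n)⁻¹) + I * ↑(((2 : ℝ) ^ n)⁻¹))‖ ≤
        c * ((2 : ℝ) ^ n) ^ e)
    {x : ℝ} (hx : |x| + 1 ≤ R) {σ : ℝ} (hσ0 : 0 < σ) (hσ1 : σ ≤ 1) :
    ‖fHat W t (x + σ * I) - bdryInv W t ((W t : ℂ) + x)‖ ≤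
      2 * (12 ^ 4 * c) / (1 - (2 : ℝ) ^ (e - 1)) * σ ^ (1 - e) := by
  have hf := differentiableOn_fHat hW t
  have hinj := injOn_fHat hW t
  have hder : ∀ y : ℝ, 0 < y → y ≤ 1 →
      ‖deriv (fHat W t) (x + y * I)‖ ≤ 12 ^ 4 * c * y ^ (-e) := fun y hy0 hy1 ↦
    norm_deriv_le_rpow_of_grid hf hinj he0 hgrid hx hy0 hy1
  have hN : ∀ N : ℕ, ‖fHat W t (x + σ * I) - fHat W t (x + (σ * 2⁻¹ ^ N : ℝ) * I)‖ ≤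
      2 * (12 ^ 4 * c) / (1 - (2 : ℝ) ^ (e - 1)) * σ ^ (1 - e) :=
    fun N ↦ norm_sub_le_rpow_of_deriv hf hinj he1 hder hσ0 hσ1 N
  -- the limit `f̂ₜ(x + iσ2⁻ᴺ) → f̄ₜ(W_t + x)`
  set v : ℂ := (W t : ℂ) + x with hv
  have hvim : 0 ≤ v.im := by simp [hv]
  have hseq : Tendsto (fun N : ℕ ↦ (W t : ℂ) + ((x : ℂ) + ((σ * 2⁻¹ ^ N : ℝ) : ℂ) * I))
      atTop (𝓝[upperHalfPlaneSet] v) := by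
    refine tendsto_nhdsWithin_iff.2 ⟨?_, Eventually.of_forall fun N ↦ ?_⟩
    · have h0 : Tendsto (fun N : ℕ ↦ σ * 2⁻¹ ^ N) atTop (𝓝 0) := by
        simpa using (tendsto_pow_atTop_nhds_zero_of_lt_one (by norm_num : (0 : ℝ) ≤ 2⁻¹)
          (by norm_num : (2⁻¹ : ℝ) < 1)).const_mul σ
      have h1 : Tendsto (fun N : ℕ ↦ ((σ * 2⁻¹ ^ N : ℝ) : ℂ) * I) atTop (𝓝 0) := by
        simpa using ((Complex.continuous_ofReal.tendsto 0).comp h0).mul_const I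
      simpa [hv] using (h1.const_add (x : ℂ)).const_add (W t : ℂ)
    · show 0 < ((W t : ℂ) + ((x : ℂ) + ((σ * 2⁻¹ ^ N : ℝ) : ℂ) * I)).im
      simp only [add_im, ofReal_im, mul_im, ofReal_re, I_im, I_re, mul_one, mul_zero, zero_add,
        add_zero]
      positivity
  have hlim : Tendsto (fun N : ℕ ↦ fHat W t (x + (σ * 2⁻¹ ^ N : ℝ) * I)) atTop
      (𝓝 (bdryInv W t v)) := by
    have h := (hγ.tendsto_bdryInv hW t hvim).comp hseq
    simpa only [Function.comp_def, fHat_apply] using h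
  have htend : Tendsto (fun N : ℕ ↦ ‖fHat W t (x + σ * I) - fHat W t (x + (σ * 2⁻¹ ^ N : ℝ) * I)‖)
      atTop (𝓝 ‖fHat W t (x + σ * I) - bdryInv W t v‖) :=
    (tendsto_const_nhds.sub hlim).norm
  exact le_of_tendsto' htend hN

end Loewner

section Cor53

variable {Ω : Type*} [MeasurableSpace Ω] {P : Measure Ω}

/-- **Rohde–Schramm (2005), Cor. 5.3 for `κ ≥ 8`, from Cor. 3.5 — general Brownian motion,
`t ≤ 1`**: if `B` is a Brownian motion with continuous paths whose chain `√κ B` is almost surely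
generated by a curve, then for `t ≤ 1` almost surely `volume (frontier Kₜ) = 0`. A point of
`frontier Kₜ` off the (null) real line is a boundary value `f̂ₜ(x) ∉ Hₜ`
(`IsGeneratedByCurve.exists_bdryInv_eq_of_mem_frontier_hull`), approached Hölder-fast along the
vertical line at `x` (`IsGeneratedByCurve.norm_fHat_sub_bdryInv_le_of_grid`, from the a.s. grid
bound `RohdeSchramm2005_cor35.ae_exists_grid_plane_of_le`), so the porosity/density lemma
`Literature.Analysis.Complex.volume_eq_zero_of_norm_sub_le_rpow` applies. (The printed proof uses
Thm. 5.2 and Jones–Makarov's dimension bound.) [cite: RohdeSchramm2005, Cor 5.3] -/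
theorem ae_volume_frontier_hull_eq_zero_of_cor35_of_le (h35 : RohdeSchramm2005_cor35 P) {κ : ℝ≥0}
    (hκ : 8 ≤ κ)
    {B : ℝ≥0 → Ω → ℝ} (hB : IsBrownianReal B P) (hBc : ∀ ω, Continuous (B · ω))
    (hgen : ∀ᵐ ω ∂P, ∃ γ, Loewner.IsGeneratedByCurve (fun s ↦ Real.sqrt κ * B s ω) γ)
    {t : ℝ≥0} (ht : t ≤ 1) :
    ∀ᵐ ω ∂P, volume (frontier (Loewner.hull (fun s ↦ Real.sqrt κ * B s ω) t)) = 0 := by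
  have hgrid : ∀ᵐ ω ∂P, ∀ R : ℕ, ∃ c : ℝ, ∀ (n : ℕ) (j : ℤ), |(j : ℝ)| ≤ R * 2 ^ n →
      ‖deriv (Loewner.fHat (fun s ↦ Real.sqrt κ * B s ω) t)
        (↑((j : ℝ) * ((2 : ℝ) ^ n)⁻¹) + I * ↑(((2 : ℝ) ^ n)⁻¹))‖ ≤
        c * ((2 : ℝ) ^ n) ^ (39 / 40 : ℝ) :=
    ae_all_iff.2 fun R ↦ h35.ae_exists_grid_plane_of_le hκ hB hBc ht R
  filter_upwards [hgrid, hgen] with ω hgridω hgenω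
  set W : ℝ≥0 → ℝ := fun s ↦ Real.sqrt κ * B s ω with hW_def
  have hW : Continuous W := continuous_const.mul (hBc ω)
  obtain ⟨γ, hγ⟩ := hgenω
  -- the part of the frontier off the real line
  have hS : volume {z ∈ frontier (Loewner.hull W t) | 0 < z.im} = 0 := by
    refine volume_eq_zero_of_norm_sub_le_rpow (Loewner.differentiableOn_fHat hW t)
      (Loewner.injOn_fHat hW t) (by rw [Loewner.image_fHat hW t]; exact Loewner.isOpen_domain hW t)
      fun w hw ↦ ?_
    obtain ⟨hwdom, v, hv⟩ := hγ.exists_bdryInv_eq_of_mem_frontier_hull hW t hw.1 hw.2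
    refine ⟨by rwa [Loewner.image_fHat hW t], v - W t,
      2 * (12 ^ 4 * (hgridω (⌈|v - W t|⌉₊ + 1)).choose) / (1 - (2 : ℝ) ^ ((39 / 40 : ℝ) - 1)),
      1 - (39 / 40 : ℝ), by norm_num, fun σ hσ0 hσ1 ↦ ?_⟩
    have hx : |v - W t| + 1 ≤ ((⌈|v - W t|⌉₊ + 1 : ℕ) : ℝ) := by
      push_cast
      linarith [Nat.le_ceil |v - W t|]
    have h := hγ.norm_fHat_sub_bdryInv_le_of_grid hW t (by norm_num) (by norm_num)
      (hgridω (⌈|v - W t|⌉₊ + 1)).choose_spec hx hσ0 hσ1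
    have hvx : (W t : ℂ) + ((v - W t : ℝ) : ℂ) = (v : ℂ) := by push_cast; ring
    rwa [hvx, hv] at h
  -- the rest of the frontier is on the real line
  have hsub : frontier (Loewner.hull W t) ⊆
      {z ∈ frontier (Loewner.hull W t) | 0 < z.im} ∪ {z : ℂ | z.im = 0} := by
    intro z hz
    rcases lt_or_ge 0 z.im with him | him
    · exact Or.inl ⟨hz, him⟩
    · refine Or.inr (le_antisymm him ?_)
      have : z ∈ closure upperHalfPlaneSet := closure_mono (Loewner.hull_subset W t) hz.1
      rw [show closure upperHalfPlaneSet = {z : ℂ | 0 ≤ z.im} from closure_setOf_lt_im 0] at this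
      exact this
  exact measure_mono_null hsub (measure_union_null hS volume_setOf_im_eq_zero)

/-- **Rohde–Schramm (2005), Cor. 5.3 for `κ ≥ 8`, from Cor. 3.5 — canonical space, every `t`**:
if SLE_κ (`κ ≥ 8`) is almost surely generated by a curve (`HasSLETrace κ`) and Cor. 3.5 holds on
the canonical space, then for every `t` almost surely `volume (frontier Kₜ) = 0` for the SLE_κ
hull. For `c ≥ 1` with `c² ≥ t` the Brownian motion `c⁻¹ B(c² ·)` (`IsBrownianReal.smul`)
drives the hulls `c⁻¹ Kₛ(c² ·)` (`Loewner.hull_scale_holds`), is again covered by Cor. 3.5 and by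
`IsGeneratedByCurve.scale`, and `t/c² ≤ 1` (`ae_volume_frontier_hull_eq_zero_of_cor35_of_le`);
dilations preserve null sets. [cite: RohdeSchramm2005, Cor 5.3] -/
theorem ae_volume_frontier_sleHull_eq_zero_of_cor35
    (h35 : RohdeSchramm2005_cor35 Process.preWienerMeasure) {κ : ℝ≥0} (hκ : 8 ≤ κ)
    (h8 : HasSLETrace κ) (t : ℝ≥0) :
    ∀ᵐ ω ∂Process.preWienerMeasure, volume (frontier (sleHull κ ω t)) = 0 := by
  -- the scale `c = max t 1`, so that `t / c² ≤ 1`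
  set c : ℝ≥0 := max t 1 with hc_def
  have hc1 : 1 ≤ c := le_max_right _ _
  have hc0 : c ≠ 0 := (lt_of_lt_of_le one_pos hc1).ne'
  have hcc : c ^ 2 ≠ 0 := pow_ne_zero 2 hc0
  have htc : t / c ^ 2 ≤ 1 := by
    rw [div_le_iff₀ (pos_iff_ne_zero.2 hcc), one_mul, sq]
    exact (le_max_left t 1).trans (le_mul_of_one_le_right zero_le hc1)
  -- the rescaled Brownian motion and its driving function
  have hB := isBrownianReal_brownian'.smul hcc
  have hBc : ∀ ω : ℝ≥0 → ℝ, Continuous fun u ↦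
      (Real.sqrt ((c ^ 2 : ℝ≥0) : ℝ))⁻¹ * Process.brownian (c ^ 2 * u) ω := fun ω ↦
    continuous_const.mul ((Process.continuous_brownian ω).comp (continuous_const.mul continuous_id))
  have hsq : Real.sqrt ((c ^ 2 : ℝ≥0) : ℝ) = c := by
    push_cast
    exact Real.sqrt_sq c.2
  have hWeq : ∀ ω : ℝ≥0 → ℝ, (fun s ↦ Real.sqrt κ *
      ((Real.sqrt ((c ^ 2 : ℝ≥0) : ℝ))⁻¹ * Process.brownian (c ^ 2 * s) ω)) =
      fun s ↦ ((c⁻¹ : ℝ≥0) : ℝ) * sleDriving κ ω (s / c⁻¹ ^ 2) := by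
    intro ω
    funext s
    rw [hsq, sleDriving_apply, inv_pow, div_inv_eq_mul, mul_comm s, NNReal.coe_inv]
    ring
  -- the rescaled chain is a.s. generated by a curve
  have hgen : ∀ᵐ ω ∂Process.preWienerMeasure, ∃ γ', Loewner.IsGeneratedByCurve
      (fun s ↦ Real.sqrt κ *
        ((Real.sqrt ((c ^ 2 : ℝ≥0) : ℝ))⁻¹ * Process.brownian (c ^ 2 * s) ω)) γ' := by
    filter_upwards [h8] with ω ⟨γ, hγ⟩
    rw [hWeq ω]
    exact ⟨_, hγ.scale (inv_ne_zero hc0)⟩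
  filter_upwards [ae_volume_frontier_hull_eq_zero_of_cor35_of_le h35 hκ hB hBc hgen htc] with ω hω
  -- `hull (c⁻¹ W(c² ·)) (t/c²) = c⁻¹ · Kₜ`
  rw [hWeq ω, Loewner.hull_scale_holds _ _ (inv_ne_zero hc0),
    show t / c ^ 2 / c⁻¹ ^ 2 = t by rw [inv_pow, div_div, mul_inv_cancel₀ hcc, div_one]] at hω
  change volume (frontier ((fun z : ℂ ↦ ((c⁻¹ : ℝ≥0) : ℂ) * z) '' sleHull κ ω t)) = 0 at hω
  have hcne : (((c⁻¹ : ℝ≥0) : ℝ) : ℂ) ≠ 0 := by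
    rw [Ne, Complex.ofReal_eq_zero, NNReal.coe_eq_zero]
    exact inv_ne_zero hc0
  -- frontier commutes with the dilation, which scales the area by `c⁻²`
  set a : ℝ := ((c⁻¹ : ℝ≥0) : ℝ) with ha_def
  have ha : a ≠ 0 := NNReal.coe_ne_zero.2 (inv_ne_zero hc0)
  rw [← Homeomorph.coe_mulLeft₀ (a : ℂ) hcne, ← Homeomorph.image_frontier,
    Homeomorph.coe_mulLeft₀] at hω
  have himage : (fun z : ℂ ↦ (a : ℂ) * z) '' frontier (sleHull κ ω t) = a • frontier (sleHull κ ω t) := by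
    rw [← Set.image_smul]
    refine image_congr fun z _ ↦ ?_
    rw [Complex.real_smul]
  rw [himage, Measure.addHaar_smul, mul_eq_zero] at hω
  rcases hω with h0 | h0
  · exfalso
    rw [ENNReal.ofReal_eq_zero, Complex.finrank_real_complex] at h0
    have : (0 : ℝ) < |a ^ 2| := by positivity
    linarith
  · exact h0

/-- **Rohde–Schramm's Theorem 7.1 with the Update (`tendsto_norm_sleTrace_atTop`: for every
`κ > 0`, a.s. `|γ(t)| → ∞`) from Cor. 3.5, the simple-path step at `κ = 4`, and [LSW] Thm. 4.7.**
The `κ ≥ 8` hypothesis of `tendsto_norm_sleTrace_atTop_of_cor35_of_smallbd` — Cor. 5.3 for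
`κ ≥ 8` — is `ae_volume_frontier_sleHull_eq_zero_of_cor35` (the trace being supplied by Cor. 3.5
for `κ ≠ 8`, `hasSLETrace_of_ne_eight_of_cor35`, and by `hasSLETrace_eight` at `κ = 8`). What
remains hypothetical: Cor. 3.5 (`h35`, the named fact `RohdeSchramm2005_cor35`), the case `κ = 4`
of the simple-path step of p. 911 (`h4`), and [LSW] Thm. 4.7 (`h8e`).
[cite: RohdeSchramm2005, Thm 7.1 and Update (p. 911)] -/
theorem tendsto_norm_sleTrace_atTop_of_cor35_of_simpleStep_four_of_eight
    (h35 : RohdeSchramm2005_cor35 Process.preWienerMeasure)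
    (h4 : HasSLETrace 4 →
      ∀ᵐ ω ∂Process.preWienerMeasure, (0 : ℂ) ∉ closure (sleTrace 4 ω '' Ici 1))
    (h8e : hasSLETrace_eight) :
    tendsto_norm_sleTrace_atTop := by
  refine tendsto_norm_sleTrace_atTop_of_cor35_of_smallbd h35 h4 h8e fun {κ} hκ t ↦ ?_
  have h0 : HasSLETrace κ := by
    rcases eq_or_ne κ 8 with rfl | hκ8
    · exact h8e
    · exact hasSLETrace_of_ne_eight_of_cor35 h35 hκ8
  exact ae_volume_frontier_sleHull_eq_zero_of_cor35 h35 hκ h0 t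

/-- The same with the simple-path step quoted from the named fact
`RohdeSchramm2005_thm71_simpleStep` (used at `κ = 4` only): **`tendsto_norm_sleTrace_atTop` from
`RohdeSchramm2005_cor35`, `RohdeSchramm2005_thm71_simpleStep` and `hasSLETrace_eight`.**
[cite: RohdeSchramm2005, Thm 7.1 and Update (p. 911)] -/
theorem tendsto_norm_sleTrace_atTop_of_cor35_of_simpleStep_of_eight
    (h35 : RohdeSchramm2005_cor35 Process.preWienerMeasure)
    (hle : RohdeSchramm2005_thm71_simpleStep) (h8e : hasSLETrace_eight) :
    tendsto_norm_sleTrace_atTop :=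
  tendsto_norm_sleTrace_atTop_of_cor35_of_simpleStep_four_of_eight h35 (fun h ↦ hle le_rfl h) h8e

end Cor53

end Literature.Probability.RandomPlanarGeometry

end
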